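import Summits.HubbardSuperconductivity.HubbardSuperconductivity.Theorems.AnisotropyChordTransferFibre3TwoChannel

/-!
# Route `AnisotropyChord` / H0 rotor rung: PartN40 — the ONE-HOLE ℤ² SKELETON STRUCTURE, PROVED

PORT PartN40 (`…Fibre3TwoChannel`, theory seat `hubbard-h0-rotor-theory-1` g21, memo 21 §317/§324(f)) types
`TwoChannel.OneHoleSkeleton : Prop`: the infinite-capacity one-hole map `P₁[A₀^∞, ∞]` of the ℤ² skeleton kernel
`A0inf` (walk units `a(1,0) = 1/2`, `a(1,1) = 2/π`, `a(2,0) = 2 − 4/π`) is positive semidefinite, annihilates `1_B`,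
and has gap `0.8` on `1_B^⊥`.  This file proves it (`oneHoleSkeleton_holds`) by the EXPLICIT inverse of `A0inf`
in the symmetry channels of the square, written over the single transcendental `p = 2/π`:
`s` (centre, `1_B`): `A⁻¹δ_c = −2δ_c + ½1_B`, `A⁻¹1_B = 2δ_c` (so `x = ½1_B`, `x_c = 0`, `s = 2` — harmonic support);
`d = (1,1,−1,−1)`: `A⁻¹ = 1/(2 − 4p)`; `p`-channel `(1,−1,0,0), (0,0,1,−1)`: `A⁻¹ = 1/(2p − 2)`.
Hence `v·P₁v = λ_d (v₁+v₂−v₃−v₄)²/4 + λ_p ((v₁−v₂)² + (v₃−v₄)²)/2` with `λ_d = 1/(4p − 2) − ½ ≈ 1.33`,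
`λ_p = 1/(2 − 2p) − ½ ≈ 0.876` (the memo's `g₀ ≈ .87597`), both `≥ 0.8` from `3 < π < 3.15` only.
Prover seat `hubbard-h0-rotor-p2` g0; helper for stmt-HubbardSuperconductivity-19089 (`--supports`, helper class).
WHAT THIS IS NOT: nothing here proves superconductivity in the Hubbard model; helper algebra of ONE conditional reduction
(rung 19089, HOLE₂(.75) far pairs, one-hole skeleton of THEOREM H2F).  Mathlib only; no sorry, no axioms.
-/

set_option linter.dupNamespace false
namespace Summit.HubbardSuperconductivity.HubbardSuperconductivity.Theorems.AnisotropyChord.Transfer.Fibre3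

namespace TwoChannel

open Matrix

/-- the skeleton kernel as a function of `p = a(1,1)` (`a(1,0) = ½`, `a(2,0) = 2 − 2p` by harmonicity). -/
noncomputable def A0infOf (p : ℝ) : Matrix (Fin 5) (Fin 5) ℝ :=
  Matrix.of fun i j =>
    if i = j then 0
    else if i = 0 ∨ j = 0 then 1 / 2
    else if (i = 1 ∧ j = 2) ∨ (i = 2 ∧ j = 1) ∨ (i = 3 ∧ j = 4) ∨ (i = 4 ∧ j = 3) then 2 - 2 * p
    else p

/-- `A0inf = A0infOf (2/π)`. -/
theorem A0inf_eq_of : A0inf = A0infOf (2 / Real.pi) := by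
  ext i j
  simp only [A0inf, A0infOf, Matrix.of_apply]
  split_ifs <;> ring

/-- the explicit inverse: centre `−2`, centre–boundary `½`, boundary block `α/4 + β/2` (diagonal), `α/4 − β/2`
(opposite pair), `−α/4` (perpendicular pair), `α = 1/(2 − 4p)`, `β = 1/(2p − 2)`. -/
noncomputable def A0infInvOf (p : ℝ) : Matrix (Fin 5) (Fin 5) ℝ :=
  Matrix.of fun i j =>
    if i = 0 ∧ j = 0 then -2
    else if i = 0 ∨ j = 0 then 1 / 2
    else if i = j then 1 / (2 - 4 * p) / 4 + 1 / (2 * p - 2) / 2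
    else if (i = 1 ∧ j = 2) ∨ (i = 2 ∧ j = 1) ∨ (i = 3 ∧ j = 4) ∨ (i = 4 ∧ j = 3) then
      1 / (2 - 4 * p) / 4 - 1 / (2 * p - 2) / 2
    else -(1 / (2 - 4 * p) / 4)

/-- `A0infOf p · A0infInvOf p = 1` off the two degenerate values `p = ½`, `p = 1`. -/
theorem A0infOf_mul_inv (p : ℝ) (h1 : 2 - 4 * p ≠ 0) (h2 : 2 * p - 2 ≠ 0) :
    A0infOf p * A0infInvOf p = 1 := by
  -- the same non-degeneracy facts in the normal forms `simp`/`field_simp` produce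
  have h1' : 2 - p * 4 ≠ 0 := fun h => h1 (by linarith)
  have h2' : -1 + p ≠ 0 := fun h => h2 (by linarith)
  have h3' : -2 + p * 4 ≠ 0 := fun h => h1 (by linarith)
  have h4' : 1 - p ≠ 0 := fun h => h2 (by linarith)
  have h5' : p - 1 ≠ 0 := fun h => h2 (by linarith)
  ext i j
  fin_cases i <;> fin_cases j <;>
    simp [A0infOf, A0infInvOf, Matrix.mul_apply, Fin.sum_univ_five] <;>
    field_simp <;> ring

/-- the bracket `0.634 < 2/π < 0.667` (from `3 < π < 3.15`) and the non-degeneracy of `p = 2/π`. -/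
theorem two_div_pi_bounds : (0.634 : ℝ) < 2 / Real.pi ∧ 2 / Real.pi < 0.667 := by
  have h3 : 3 < Real.pi := Real.pi_gt_three
  have h4 : Real.pi < 3.15 := Real.pi_lt_d2
  have hpos : 0 < Real.pi := Real.pi_pos
  constructor
  · rw [lt_div_iff₀ hpos]; nlinarith
  · rw [div_lt_iff₀ hpos]; nlinarith

/-- hence `A0inf⁻¹ = A0infInvOf (2/π)`. -/
theorem A0inf_inv : A0inf⁻¹ = A0infInvOf (2 / Real.pi) := by
  obtain ⟨hl, hu⟩ := two_div_pi_bounds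
  rw [A0inf_eq_of]
  exact Matrix.inv_eq_right_inv (A0infOf_mul_inv _ (by nlinarith) (by nlinarith))

/-- harmonic support: `x = A0inf⁻¹ 1 = ½·1_B` (centre component `0`). -/
theorem xvec_A0inf (i : Fin 5) : xvec A0inf i = if i = 0 then 0 else 1 / 2 := by
  fin_cases i <;>
    simp [xvec, A0inf_inv, A0infInvOf, Matrix.mulVec, dotProduct, Fin.sum_univ_five] <;> ring

/-- `s = 2`. -/
theorem svec_A0inf : svec A0inf = 2 := by
  simp [svec, xvec_A0inf, Fin.sum_univ_five]
  norm_num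

/-- the d-channel eigenvalue `λ_d(p) = −1/(2 − 4p) − ½ = 1/(4p − 2) − ½`. -/
noncomputable def lamD (p : ℝ) : ℝ := -(1 / (2 - 4 * p)) - 1 / 2

/-- the p-channel eigenvalue `λ_p(p) = −1/(2p − 2) − ½ = 1/(2 − 2p) − ½` (the memo's `g₀ ≈ .876` at `p = 2/π`). -/
noncomputable def lamP (p : ℝ) : ℝ := -(1 / (2 * p - 2)) - 1 / 2

/-- the infinite-capacity one-hole map of the skeleton in closed form (`Fin 4` = `e₁, −e₁, e₂, −e₂`). -/
noncomputable def PinfOf (p : ℝ) : Matrix (Fin 4) (Fin 4) ℝ :=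
  Matrix.of fun i j =>
    if i = j then lamD p / 4 + lamP p / 2
    else if (i = 0 ∧ j = 1) ∨ (i = 1 ∧ j = 0) ∨ (i = 2 ∧ j = 3) ∨ (i = 3 ∧ j = 2) then lamD p / 4 - lamP p / 2
    else -(lamD p / 4)

/-- `P₁[A0inf, ∞] = PinfOf (2/π)`. -/
theorem oneHolePinf_A0inf : oneHolePinf A0inf = PinfOf (2 / Real.pi) := by
  set p := 2 / Real.pi with hp
  ext i j
  fin_cases i <;> fin_cases j <;>
    simp [oneHolePinf, A0inf_inv, A0infInvOf, xvec_A0inf, svec_A0inf, PinfOf, lamD, lamP, ← hp] <;> ring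

/-- `1_B` is a null vector of `PinfOf p` (every `p`). -/
theorem PinfOf_mulVec_one (p : ℝ) : (PinfOf p).mulVec (fun _ => 1) = 0 := by
  ext i
  have h : ∀ i : Fin 4, (PinfOf p).mulVec (fun _ => 1) i = 0 := by
    intro i
    fin_cases i
    all_goals simp [PinfOf, Matrix.mulVec, dotProduct, Fin.sum_univ_four]
    all_goals ring
  exact h i

/-- the quadratic form in channel coordinates. -/
theorem quadForm_PinfOf (p : ℝ) (v : Fin 4 → ℝ) :
    dotProduct v ((PinfOf p).mulVec v)
      = lamD p * (v 0 + v 1 - v 2 - v 3) ^ 2 / 4 + lamP p * ((v 0 - v 1) ^ 2 + (v 2 - v 3) ^ 2) / 2 := by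
  simp [PinfOf, Matrix.mulVec, dotProduct, Fin.sum_univ_four]
  ring

/-- Parseval in the channel basis: `‖v‖² = (1·v)²/4 + (d·v)²/4 + ((v₁−v₂)² + (v₃−v₄)²)/2`. -/
theorem normSq_channels (v : Fin 4 → ℝ) :
    dotProduct v v = (v 0 + v 1 + v 2 + v 3) ^ 2 / 4 + (v 0 + v 1 - v 2 - v 3) ^ 2 / 4
      + ((v 0 - v 1) ^ 2 + (v 2 - v 3) ^ 2) / 2 := by
  simp [dotProduct, Fin.sum_univ_four]
  ring

/-- `λ_p(2/π) ≥ 0.8`. -/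
theorem lamP_ge : (0.8 : ℝ) ≤ lamP (2 / Real.pi) := by
  obtain ⟨hl, hu⟩ := two_div_pi_bounds
  set p := 2 / Real.pi
  have hden : 0 < 2 - 2 * p := by nlinarith
  unfold lamP
  rw [show (2 : ℝ) * p - 2 = -(2 - 2 * p) by ring, div_neg, neg_neg]
  have : (13 / 10 : ℝ) ≤ 1 / (2 - 2 * p) := by
    rw [le_div_iff₀ hden]; nlinarith
  linarith

/-- `λ_d(2/π) ≥ 0.8`. -/
theorem lamD_ge : (0.8 : ℝ) ≤ lamD (2 / Real.pi) := by
  obtain ⟨hl, hu⟩ := two_div_pi_bounds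
  set p := 2 / Real.pi
  have hden : 0 < 4 * p - 2 := by nlinarith
  unfold lamD
  rw [show (2 : ℝ) - 4 * p = -(4 * p - 2) by ring, div_neg, neg_neg]
  have : (13 / 10 : ℝ) ≤ 1 / (4 * p - 2) := by
    rw [le_div_iff₀ hden]; nlinarith
  linarith

/-- ★ ONE-HOLE SKELETON STRUCTURE (memo §317/§324(f)) holds: PSD, null vector `1_B`, gap `0.8` on `1_B^⊥`. -/
theorem oneHoleSkeleton_holds : OneHoleSkeleton := by
  have hP := oneHolePinf_A0inf
  have hp := lamP_ge
  have hd := lamD_ge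
  refine ⟨?_, ?_, ?_⟩
  · intro v
    rw [hP, quadForm_PinfOf]
    have : 0 ≤ lamD (2 / Real.pi) := by linarith
    have : 0 ≤ lamP (2 / Real.pi) := by linarith
    positivity
  · rw [hP]
    exact PinfOf_mulVec_one _
  · intro v hv
    rw [hP, quadForm_PinfOf, normSq_channels]
    have hsum : v 0 + v 1 + v 2 + v 3 = 0 := by
      simpa [dotProduct, Fin.sum_univ_four] using hv
    rw [hsum]
    have e1 := mul_nonneg (sub_nonneg.2 hd) (sq_nonneg (v 0 + v 1 - v 2 - v 3))
    have e2 := mul_nonneg (sub_nonneg.2 hp) (add_nonneg (sq_nonneg (v 0 - v 1)) (sq_nonneg (v 2 - v 3)))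
    nlinarith [e1, e2]

end TwoChannel

end Summit.HubbardSuperconductivity.HubbardSuperconductivity.Theorems.AnisotropyChord.Transfer.Fibre3
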